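import Literature.Topology.FourManifolds.DehnSurgery
import Literature.Topology.FourManifolds.LinkingNumberProofs
import Literature.Topology.FourManifolds.GluckTwistSimplyConnected
import Literature.Topology.FourManifolds.GluckTwistMeridian
import Literature.Topology.FourManifolds.TorusCoordinates
import Literature.AlgebraicTopology.FundamentalGroup.VanKampenKernel
import Literature.AlgebraicTopology.FundamentalGroup.PuncturedPlane
import Literature.AlgebraicTopology.FundamentalGroup.SphereSimplyConnected
import Mathlib.Analysis.Convex.Contractible
import HarnessLib

/-!
# The framing integer of a tubular neighbourhood exists: the knot group is normally generated by the meridian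

Sibling proof file of `DehnSurgery.lean` (D-0014: named facts `def X : Prop` are discharged as
`theorem X_holds : X`, bottom-up) for the named fact
`Literature.Topology.FourManifolds.Knot.TubularNbhd.existsUnique_hasFraming` (*the framing of an oriented tubular neighbourhood
`ν : S¹ × ℝ² ↪ S³` of a smooth knot `K` is well defined*: `∃! m : ℤ, ν.HasFraming m`, i.e.
`[longitude] = m • [meridian]` in `H₁(S³ ∖ K) = π₁(S³ ∖ K, p₀)ᵃᵇ` for exactly one `m`; Rolfsen,
*Knots and Links* (1976), §5.D, §9.F). That fact is the conjunction of two classical statements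
about the abelianised knot group (Crowell–Fox, *Introduction to Knot Theory*, Ch. VIII §1,
pp. 99–100 of the GTM 57 edition):

* (1.1) *every abelian homomorphic image of a knot group is cyclic, generated by the image of any
  meridian generator* — this gives the **existence** of `m`;
* (1.2) *the abelianised knot group is infinite cyclic*, the proof mapping every meridian
  generator onto a generator `t` of `ℤ` — so the meridian has infinite order, which gives the
  **uniqueness** of `m`.

This file **proves** the first statement for smooth knots (in the strong form: the knot group is
the normal closure of the meridian) and hence the existence half, vendors the second as the one
remaining named fact (leaf), and assembles:

* `Literature.Topology.FourManifolds.Knot.TubularNbhd.normalClosure_meridian_eq_top` (**proved**): for a smooth knot `K` with an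
  oriented tubular neighbourhood `ν`, the normal closure of the class of `ν.meridian` in
  `π₁(S³ ∖ K, p₀)` is the whole group;
* `Literature.Topology.FourManifolds.Knot.TubularNbhd.abelianization_mem_zpowers_meridian`, `Literature.Topology.FourManifolds.Knot.TubularNbhd.exists_hasFraming`
  (**proved**): every class of `π₁(S³ ∖ K, p₀)ᵃᵇ` is a power of the class of the meridian; in
  particular `∃ m, ν.HasFraming m`;
* `Literature.Topology.FourManifolds.Knot.TubularNbhd.zpow_meridian_injective` (**named fact**, Crowell–Fox VIII (1.2)):
  `m ↦ m • [meridian]` is injective `ℤ → π₁(S³ ∖ K, p₀)ᵃᵇ`;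
* `Literature.Topology.FourManifolds.Knot.TubularNbhd.existsUnique_hasFraming_of` (**proved**): the leaf implies
  `ν.existsUnique_hasFraming`.

Used on the way (from `LinkingNumberProofs.lean`): the range of a tubular neighbourhood is open
(`Knot.TubularNbhd.isOpen_range`, invariance of domain) and the complement of a smooth knot admitting
a tubular neighbourhood is path connected (`Knot.TubularNbhd.isPathConnected_compl_range`).

## Proof of `normalClosure_meridian_eq_top`

Seifert–van Kampen in kernel form (`Literature.AlgebraicTopology.FundamentalGroup.VanKampen.fromPath_mem_of_homotopic_refl`, Hatcher,
*Algebraic Topology*, Thm. 1.20; `Literature/AlgebraicTopology/FundamentalGroup/VanKampenKernel.lean`),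
as in the tree's proof of Kervaire's lemma for 2-knots
(`Literature.Topology.FourManifolds.TwoKnot.normalClosure_meridian_eq_top_holds`, `GluckTwistMeridian.lean`), with one change
forced by `π₁(S¹) ≠ 1`: the full tube `ν(S¹ × (ℝ² ∖ 0)) ≃ T²` also carries the longitude, so we use
the *partial* tube over the circle minus the antipode `ptB = (-1, 0)` of the base angle and remove
the point `K(ptB)` from the ambient sphere. Precisely, with `Y = S³ ∖ {K(ptB)}`,
`U = S³ ∖ K ⊆ Y` and `T = ν((S¹ ∖ {ptB}) × ℝ²) ⊆ Y`:

* `Y` is simply connected (`Literature.AlgebraicTopology.FundamentalGroup.isSimplyConnected_compl_singleton_sphere`: stereographic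
  projection), so every loop of `U` is null-homotopic in `Y`;
* `U`, `T` are open (`T` by invariance of domain, `Manifold.IsSmoothEmbedding.isOpenMap_of_finrank_eq`)
  and cover `Y` (a point `K a`, `a ≠ ptB`, is `ν (a, 0) ∈ T`);
* `U` is path connected (`Knot.TubularNbhd.isPathConnected_compl_range`, `LinkingNumberProofs.lean`:
  `S³ = (S³ ∖ K) ∪ ν(S¹ × ℝ²)` with connected intersection `ν(S¹ × (ℝ² ∖ 0))`);
* `U ∩ T = ν((S¹ ∖ {ptB}) × (ℝ² ∖ 0))` is path connected, and every loop of `U` at `p₀` inside `T`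
  is a power of the meridian (`fromPath_mem_zpowers_meridian`): pulled back along the embedding
  `ν` and the angle function `angB : S¹ ∖ {ptB} → (1/2, 3/2)` (`TorusCoordinates.lean`) it is a
  loop of `(1/2, 3/2) × (ℂ ∖ 0)`, whose class is a power of the slice winding loop because the
  interval is simply connected and `π₁(ℂ ∖ 0)` is generated by the winding loop
  (`Literature.AlgebraicTopology.FundamentalGroup.PuncturedPlane.fromPath_mem_zpowers_slice`, via the covering `exp`);
* the statement is moved between `π₁` of the knot complement `↥K.complement` and of its copy
  `U ⊆ Y` along the evident homeomorphism, using `Literature.Topology.FourManifolds.FundamentalGroup.mapOfEq_fromPath_eq`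
  in both directions (no isomorphism of fundamental groups is needed, only that normal closures
  are mapped into normal closures).

The abelian consequence: the preimage of `⟨[μ]ᵃᵇ⟩` under `π₁ → π₁ᵃᵇ` is a normal subgroup
containing `[μ]`, hence everything.

## What remains for `existsUnique_hasFraming_holds`

Only the leaf `zpow_meridian_injective` (the meridian has infinite order in `H₁(S³ ∖ K)`), i.e. a
homomorphism `π₁(S³ ∖ K, p₀) → ℤ` taking the value `±1` on the meridian (a linking number with
`K`). Suggested route with the tree's singular homology library: a Hurewicz map `π₁ᵃᵇ → H₁`
(concrete singular chains, `SingularChainsConcrete.lean`), Mayer–Vietoris for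
`S³ = (S³ ∖ K) ∪ ν(S¹ × ℝ²)` with `H₂(S³) = 0` (`ExcisionMayerVietoris.lean`, `SphereHomology.lean`),
and the angle cocycle `H₁(ℂ ∖ 0; ℤ) → ℝ` from continuous logarithms
(`Literature/Topology/PlaneTopology/WindingNumber.lean`) to see that the winding loop, hence the
meridian of the punctured tube, has infinite order.

## References

* R. H. Crowell, R. H. Fox, *Introduction to Knot Theory*, Ginn 1963 (Springer GTM 57, 1977),
  Ch. VIII §1, (1.1)–(1.2), pp. 99–100 [CrowellFox1963].
* D. Rolfsen, *Knots and Links*, Publish or Perish (1976), §3.A, §5.D (Thm 2), §9.F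
  [Rolfsen1976].
* A. Hatcher, *Algebraic Topology*, CUP (2002), Thm. 1.7, Thm. 1.20 [HatcherAT2002].
* M. A. Kervaire, *Les nœuds de dimensions supérieures*, Bull. SMF 93 (1965), Ch. I, Lemme 1.2
  (the model argument) [KervaireBSMF1965].

## Design notes

* No new instance is registered; `SimplyConnectedSpace (Ioo (1/2) (3/2))` is a theorem used with
  `haveI`.
* The auxiliary circle lemmas (`circlePt_one`, `angB_circlePoint_zero`, `circlePt_ne_ptB`,
  `compl_ptB_eq_image`, `continuousAt_angB`, `circlePoint_zero_eq_ptA`) live in the namespace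
  `Literature.Topology.FourManifolds.Knot.TubularNbhd` of this file to avoid clashes with the specialised variants of
  `SectionCircleNbhd.lean` (not imported: it carries the Cappell–Shaneson mapping-torus library).
* No declaration in this file uses `sorry`; `exists_hasFraming` and `existsUnique_hasFraming_of`
  depend only on the axioms `propext`, `Classical.choice`, `Quot.sound`.
-/

noncomputable section

open Complex hiding I
open Set Function unitInterval
open scoped Topology Manifold ContDiff Real

namespace Literature.Topology.FourManifolds

/-- Local notation: `𝔼 n` is the model Euclidean space `EuclideanSpace ℝ (Fin n)`. -/
local notation "𝔼 " n:arg => EuclideanSpace ℝ (Fin n)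

/-- Local notation: `𝕊 n` is the unit sphere in `EuclideanSpace ℝ (Fin (n + 1))`. -/
local notation "𝕊 " n:arg => (Metric.sphere (0 : EuclideanSpace ℝ (Fin (n + 1))) 1)

namespace Knot.TubularNbhd

section Topology

variable {K : Knot} (ν : Knot.TubularNbhd K)

/-- Images of open sets under a tubular neighbourhood are open (invariance of domain for the
equidimensional smooth embedding `ν`, `Manifold.IsSmoothEmbedding.isOpenMap_of_finrank_eq`; the
case of the whole range is `Knot.TubularNbhd.isOpen_range`, `LinkingNumberProofs.lean`).
[folklore] -/
theorem isOpen_image {s : Set ((𝕊 1) × 𝔼 2)} (hs : IsOpen s) : IsOpen (ν '' s) :=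
  Manifold.IsSmoothEmbedding.isOpenMap_of_finrank_eq ν.isSmoothEmbedding (by simp) s hs

/-- The part of an image `ν(s)` lying in the knot complement is the image of the part of `s`
off the zero section (the case `s = univ` is `Knot.TubularNbhd.compl_range_inter_range`,
`LinkingNumberProofs.lean`). [folklore] -/
theorem compl_range_inter_image (s : Set ((𝕊 1) × 𝔼 2)) :
    (range K)ᶜ ∩ ν '' s = ν '' (s ∩ {p | p.2 ≠ 0}) := by
  ext a
  constructor
  · rintro ⟨ha, ⟨y, w⟩, hs, rfl⟩
    refine ⟨(y, w), ⟨hs, ?_⟩, rfl⟩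
    rintro (rfl : w = 0)
    exact ha ⟨y, (ν.coe_apply_zero y).symm⟩
  · rintro ⟨⟨y, w⟩, ⟨hs, hw⟩, rfl⟩
    exact ⟨ν.apply_mem_compl_range hw, mem_image_of_mem _ hs⟩

end Topology

/-! ### Loops in the punctured partial tube are powers of the meridian -/

section Slice

open PlaneComplex

variable {K : Knot} (ν : Knot.TubularNbhd K)

/-- The angle interval `(1/2, 3/2)`, parametrising the circle minus the antipode `ptB = (-1, 0)`
of the base angle by `circlePt` (inverse `angB`, `TorusCoordinates.lean`). [folklore] -/
abbrev angleIoo : Set ℝ := Ioo (1 / 2 : ℝ) (3 / 2)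

/-- The base angle `1 ∈ (1/2, 3/2)` (`circlePt 1 = circlePoint 0`). [folklore] -/
def baseAngle : angleIoo := ⟨1, by norm_num, by norm_num⟩

/-- Value of the base angle. [folklore] -/
@[simp] theorem coe_baseAngle : (baseAngle : ℝ) = 1 := rfl

/-- The angle interval is simply connected (it is convex). [folklore] -/
theorem simplyConnectedSpace_angleIoo : SimplyConnectedSpace angleIoo := by
  haveI : ContractibleSpace angleIoo :=
    Convex.contractibleSpace (convex_Ioo _ _) ⟨1, by norm_num, by norm_num⟩
  infer_instance

/-- `circlePt 1 = circlePoint 0`. [folklore] -/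
theorem circlePt_one : circlePt 1 = circlePoint 0 := by
  rw [circlePt_eq_circlePoint, circlePoint_two_pi_mul_one]

/-- `angB (circlePoint 0) = 1`. [folklore] -/
theorem angB_circlePoint_zero : angB (circlePoint 0) = 1 := by
  rw [← circlePt_one]
  exact angB_circlePt ⟨by norm_num, by norm_num⟩

/-- `angB ptB = 3/2` (also `Literature.Topology.FourManifolds.angB_ptB` in `SectionCircleNbhd.lean`, not imported). [folklore] -/
private theorem angB_ptB : angB ptB = 3 / 2 := by
  rw [angB, toC_ptB, Complex.arg_neg_one]
  have hπ : (π : ℝ) ≠ 0 := Real.pi_ne_zero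
  field_simp
  ring

/-- For `θ ∈ (1/2, 3/2)`, `circlePt θ ≠ ptB`. [folklore] -/
theorem circlePt_ne_ptB {θ : ℝ} (hθ : θ ∈ angleIoo) : circlePt θ ≠ ptB := fun h ↦ by
  have := angB_circlePt hθ
  rw [h, angB_ptB] at this
  exact absurd hθ.2 (by rw [← this]; exact lt_irrefl _)

/-- The circle minus `ptB` is the image of `(1/2, 3/2)` under `circlePt`. [folklore] -/
theorem compl_ptB_eq_image : ({ptB}ᶜ : Set (𝕊 1)) = circlePt '' angleIoo := by
  ext u
  constructor
  · intro hu
    exact ⟨angB u, angB_mem_Ioo hu, circlePt_angB u⟩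
  · rintro ⟨θ, hθ, rfl⟩
    exact circlePt_ne_ptB hθ

/-- `angB` is continuous away from `ptB`. [folklore] -/
theorem continuousAt_angB {u : 𝕊 1} (hu : u ≠ ptB) : ContinuousAt angB u :=
  (contMDiffAt_angB hu).continuousAt

/-- The **punctured partial tube map** `(1/2, 3/2) × (ℂ ∖ 0) → S³ ∖ K`,
`(θ, z) ↦ ν (circlePt θ, z)` (plane identified with `ℂ`); it takes values in the knot
complement by `Knot.TubularNbhd.apply_mem_compl_range`. [folklore] -/
def tubeMap : C(angleIoo × Literature.AlgebraicTopology.FundamentalGroup.PuncturedPlane.CStar, K.complement) where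
  toFun a := ⟨ν (circlePt a.1, ofC (a.2 : ℂ)), ν.apply_mem_compl_range (ofC_ne_zero a.2.2)⟩
  continuous_toFun :=
    (ν.continuous.comp ((continuous_circlePt.comp (continuous_subtype_val.comp continuous_fst)).prodMk
      (continuous_ofC.comp (continuous_subtype_val.comp continuous_snd)))).subtype_mk _

/-- Values of the tube map. [folklore] -/
theorem tubeMap_apply_coe (a : angleIoo × Literature.AlgebraicTopology.FundamentalGroup.PuncturedPlane.CStar) :
    (ν.tubeMap a : 𝕊 3) = ν (circlePt a.1, ofC (a.2 : ℂ)) := rfl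

/-- The tube map sends `(1, 1/2)` to the base point `p₀ = ν ((1, 0), (1/2, 0))`. [folklore] -/
theorem tubeMap_base :
    ν.tubeMap (baseAngle, Literature.AlgebraicTopology.FundamentalGroup.PuncturedPlane.bpt (1 / 2) one_half_pos) = ν.basePoint := by
  apply Subtype.ext
  rw [tubeMap_apply_coe, coe_basePoint, framingBaseVector, coe_baseAngle, circlePt_one,
    Literature.AlgebraicTopology.FundamentalGroup.PuncturedPlane.bpt_coe]
  congr 2
  rw [← ofC_polar (1 / 2) 0]
  simp

/-- The meridian is the image of the slice winding loop under the tube map. [folklore] -/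
theorem meridian_eq_tubeMap (t : I) :
    ν.meridian t = ν.tubeMap (Literature.AlgebraicTopology.FundamentalGroup.PuncturedPlane.sliceWindingLoop baseAngle (1 / 2) one_half_pos t) := by
  apply Subtype.ext
  rw [coe_meridian_apply, tubeMap_apply_coe, Literature.AlgebraicTopology.FundamentalGroup.PuncturedPlane.sliceWindingLoop_apply,
    Literature.AlgebraicTopology.FundamentalGroup.PuncturedPlane.windingLoop_apply_coe, ofC_polar, coe_baseAngle, circlePt_one]
  simp

/-- **Loops in the punctured partial tube are powers of the meridian.** Every loop of `S³ ∖ K` at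
the base point `p₀` lying in the partial tube `ν((S¹ ∖ {ptB}) × ℝ²)` has its class in the cyclic
subgroup generated by the meridian: pulled back by the embedding `ν` and the angle `angB` it is a
loop of `(1/2, 3/2) × (ℂ ∖ 0)`, whose class is a power of the slice winding loop
(`PuncturedPlane.fromPath_mem_zpowers_slice`, the interval being simply connected), and the slice
winding loop maps to the meridian. [folklore] -/
theorem fromPath_mem_zpowers_meridian (δ : Path ν.basePoint ν.basePoint)
    (hδ : ∀ t, (δ t : 𝕊 3) ∈ ν '' {p | p.1 ≠ ptB}) :
    FundamentalGroup.fromPath (Path.Homotopic.Quotient.mk δ) ∈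
      Subgroup.zpowers (FundamentalGroup.fromPath (Path.Homotopic.Quotient.mk ν.meridian)) := by
  haveI : SimplyConnectedSpace angleIoo := simplyConnectedSpace_angleIoo
  have hr : (0 : ℝ) < 1 / 2 := one_half_pos
  -- pull the loop back to `S¹ × ℝ²` through the embedding `ν`
  let eν := ν.isSmoothEmbedding_coe.isEmbedding.toHomeomorph
  have hδr : ∀ t, (δ t : 𝕊 3) ∈ range ν := fun t => image_subset_range _ _ (hδ t)
  let q : I → (𝕊 1) × 𝔼 2 := fun t => eν.symm ⟨(δ t : 𝕊 3), hδr t⟩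
  have hq : Continuous q :=
    eν.symm.continuous.comp ((continuous_subtype_val.comp δ.continuous).subtype_mk _)
  have hνq : ∀ t, ν (q t) = δ t := fun t => by
    have h := congrArg Subtype.val (eν.apply_symm_apply ⟨(δ t : 𝕊 3), hδr t⟩)
    rwa [Topology.IsEmbedding.toHomeomorph_apply_coe] at h
  have hq1 : ∀ t, (q t).1 ≠ ptB := fun t h1 => by
    obtain ⟨p, hp, hpt⟩ := hδ t
    have : p = q t := ν.injective (hpt.trans (hνq t).symm)
    exact hp (this ▸ h1)
  have hq2 : ∀ t, (q t).2 ≠ 0 := fun t h0 => (δ t).2 ⟨(q t).1, by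
    have h' : ((q t).1, (0 : 𝔼 2)) = q t := Prod.ext rfl h0.symm
    rw [← ν.coe_apply_zero, h', hνq t]⟩
  have hbase : ∀ t, (δ t : 𝕊 3) = ν (circlePoint 0, framingBaseVector) →
      q t = (circlePoint 0, framingBaseVector) := fun t ht => by
    change eν.symm ⟨(δ t : 𝕊 3), hδr t⟩ = _
    have : (⟨(δ t : 𝕊 3), hδr t⟩ : range ν) = ⟨ν (circlePoint 0, framingBaseVector), ⟨_, rfl⟩⟩ :=
      Subtype.ext ht
    rw [this]
    exact Topology.IsEmbedding.toHomeomorph_symm_apply _ _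
  have hq0 : q 0 = (circlePoint 0, framingBaseVector) := hbase 0 (by rw [δ.source]; rfl)
  have hq1' : q 1 = (circlePoint 0, framingBaseVector) := hbase 1 (by rw [δ.target]; rfl)
  -- the angle coordinate
  let θ : I → ℝ := fun t => angB (q t).1
  have hθ : Continuous θ :=
    continuous_iff_continuousAt.2 fun t =>
      ContinuousAt.comp (g := angB) (f := fun t => (q t).1) (x := t)
        (continuousAt_angB (hq1 t)) hq.continuousAt.fst
  have hθmem : ∀ t, θ t ∈ angleIoo := fun t => angB_mem_Ioo (hq1 t)
  -- the loop in `(1/2, 3/2) × (ℂ ∖ 0)`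
  let b : angleIoo × Literature.AlgebraicTopology.FundamentalGroup.PuncturedPlane.CStar := (baseAngle, Literature.AlgebraicTopology.FundamentalGroup.PuncturedPlane.bpt (1 / 2) hr)
  let δA : Path b b :=
    { toFun := fun t => (⟨θ t, hθmem t⟩, ⟨toC (q t).2, toC_ne_zero (hq2 t)⟩)
      continuous_toFun := (hθ.subtype_mk _).prodMk
        ((continuous_toC.comp (continuous_snd.comp hq)).subtype_mk _)
      source' := by
        refine Prod.ext (Subtype.ext ?_) (Subtype.ext ?_)
        · change angB (q 0).1 = 1
          rw [hq0]
          exact angB_circlePoint_zero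
        · change toC (q 0).2 = ((1 / 2 : ℝ) : ℂ)
          rw [hq0, framingBaseVector, toC_polar]
          simp
      target' := by
        refine Prod.ext (Subtype.ext ?_) (Subtype.ext ?_)
        · change angB (q 1).1 = 1
          rw [hq1']
          exact angB_circlePoint_zero
        · change toC (q 1).2 = ((1 / 2 : ℝ) : ℂ)
          rw [hq1', framingBaseVector, toC_polar]
          simp }
  have hδA : ∀ t, δ t = ν.tubeMap (δA t) := fun t => by
    apply Subtype.ext
    change (δ t : 𝕊 3) = ν (circlePt (angB (q t).1), ofC (toC (q t).2))
    rw [circlePt_angB, ofC_toC, Prod.mk.eta, hνq]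
  have hb : ν.tubeMap b = ν.basePoint := ν.tubeMap_base
  have e1 := FundamentalGroup.mapOfEq_fromPath_eq ν.tubeMap hb δA δ hδA
  have e2 := FundamentalGroup.mapOfEq_fromPath_eq ν.tubeMap hb
    (Literature.AlgebraicTopology.FundamentalGroup.PuncturedPlane.sliceWindingLoop baseAngle (1 / 2) hr) ν.meridian ν.meridian_eq_tubeMap
  obtain ⟨k, hk⟩ := Subgroup.mem_zpowers_iff.1
    (Literature.AlgebraicTopology.FundamentalGroup.PuncturedPlane.fromPath_mem_zpowers_slice baseAngle (1 / 2) hr δA)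
  rw [← e1, ← hk, map_zpow, e2]
  exact Subgroup.zpow_mem _ (Subgroup.mem_zpowers _) k

end Slice


/-! ### The knot group is normally generated by the meridian (van Kampen) -/

section VanKampen

variable {K : Knot} (ν : Knot.TubularNbhd K)

/-- `circlePoint 0 = ptA`. [folklore] -/
theorem circlePoint_zero_eq_ptA : circlePoint 0 = ptA := by
  rw [ptA, circlePt_eq_circlePoint, mul_zero]

/-- The punctured sphere `S³ ∖ {K(-1, 0)}`, the ambient space of the van Kampen argument (it is
simply connected, and it is covered by the knot complement and the partial tube
`ν((S¹ ∖ {(-1, 0)}) × ℝ²)`). [folklore] -/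
abbrev puncturedSphere (K : Knot) : Set (𝕊 3) := {K ptB}ᶜ

/-- The knot complement lies in the punctured sphere. [folklore] -/
theorem coe_mem_puncturedSphere (x : K.complement) : (x : 𝕊 3) ∈ puncturedSphere K :=
  fun h => x.2 ⟨ptB, (mem_singleton_iff.1 h).symm⟩

/-- The knot complement as a subset of the punctured sphere. [folklore] -/
abbrev complInPunctured (K : Knot) : Set (puncturedSphere K) :=
  {y | (y : 𝕊 3) ∈ (K.complement : Set (𝕊 3))}

/-- The partial tube `ν((S¹ ∖ {(-1, 0)}) × ℝ²)` as a subset of the punctured sphere. [folklore] -/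
abbrev tubeInPunctured : Set (puncturedSphere K) :=
  {y | (y : 𝕊 3) ∈ ν '' {p | p.1 ≠ ptB}}

/-- The identification of the knot complement with its copy inside the punctured sphere.
[folklore] -/
def toComplInPunctured (K : Knot) : C(K.complement, complInPunctured K) where
  toFun x := ⟨⟨x, coe_mem_puncturedSphere x⟩, x.2⟩
  continuous_toFun := (continuous_subtype_val.subtype_mk _).subtype_mk _

/-- The inverse identification. [folklore] -/
def ofComplInPunctured (K : Knot) : C(complInPunctured K, K.complement) where
  toFun y := ⟨(y : puncturedSphere K), y.2⟩
  continuous_toFun := (continuous_subtype_val.comp continuous_subtype_val).subtype_mk _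

/-- `ofComplInPunctured ∘ toComplInPunctured = id`. [folklore] -/
@[simp] theorem ofComplInPunctured_toComplInPunctured (x : K.complement) :
    ofComplInPunctured K (toComplInPunctured K x) = x := rfl

/-- `toComplInPunctured ∘ ofComplInPunctured = id`. [folklore] -/
@[simp] theorem toComplInPunctured_ofComplInPunctured (y : complInPunctured K) :
    toComplInPunctured K (ofComplInPunctured K y) = y := rfl

/-- **The knot group is normally generated by the meridian** (Crowell–Fox, *Introduction to Knot
Theory*, Ch. VIII (1.1) for tame knots via over presentations: all meridian generators are
conjugate; here for smooth knots with a tubular neighbourhood, by Seifert–van Kampen in kernel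
form, `VanKampen.fromPath_mem_of_homotopic_refl`, Hatcher Thm. 1.20, exactly as Kervaire's lemma
`TwoKnot.normalClosure_meridian_eq_top_holds` for 2-knots): the normal closure of the class of the
meridian `ν.meridian` in `π₁(S³ ∖ K, p₀)` is the whole group. The cover used is
`S³ ∖ {K(-1,0)} = (S³ ∖ K) ∪ ν((S¹ ∖ {(-1,0)}) × ℝ²)`: the punctured sphere is simply connected
(`AlgTop.isSimplyConnected_compl_singleton_sphere`), both pieces and their intersection
`ν((S¹ ∖ {(-1,0)}) × (ℝ² ∖ 0))` are path connected, and loops of the complement inside the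
partial tube are powers of the meridian (`fromPath_mem_zpowers_meridian`).
[cite: CrowellFox1963, Ch. VIII (1.1)] [cite: HatcherAT2002, Thm. 1.20] -/
theorem normalClosure_meridian_eq_top :
    Subgroup.normalClosure
      {(FundamentalGroup.fromPath (Path.Homotopic.Quotient.mk ν.meridian) :
        FundamentalGroup K.complement ν.basePoint)} = ⊤ := by
  -- notation
  let Y : Set (𝕊 3) := puncturedSphere K
  let U : Set Y := complInPunctured K
  let T : Set Y := ν.tubeInPunctured
  let φ : C(K.complement, U) := toComplInPunctured K
  let ψ : C(U, K.complement) := ofComplInPunctured K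
  let b : K.complement := ν.basePoint
  let μ : FundamentalGroup K.complement b :=
    FundamentalGroup.fromPath (Path.Homotopic.Quotient.mk ν.meridian)
  let x₀ : Y := (φ b : U)
  have hxU : x₀ ∈ U := (φ b).2
  -- the ambient punctured sphere is simply connected
  haveI : SimplyConnectedSpace Y :=
    (Literature.AlgebraicTopology.FundamentalGroup.isSimplyConnected_compl_singleton_sphere (K ptB)).simplyConnectedSpace
  -- openness
  have hUo : IsOpen U := K.complement.isOpen.preimage continuous_subtype_val
  have hTo : IsOpen T :=
    (ν.isOpen_image (isOpen_compl_singleton.preimage continuous_fst)).preimage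
      continuous_subtype_val
  -- the cover
  have hUT : U ∪ T = univ := by
    refine eq_univ_of_forall fun y => ?_
    by_cases hy : (y : 𝕊 3) ∈ range K
    · obtain ⟨a, ha⟩ := hy
      refine Or.inr ⟨(a, 0), ?_, by rw [ν.coe_apply_zero, ha]⟩
      rintro (rfl : a = ptB)
      exact y.2 ha.symm
    · exact Or.inl hy
  -- path connectedness of the pieces
  have hval : Topology.IsInducing (Subtype.val : Y → 𝕊 3) := Topology.IsInducing.subtypeVal
  have hUpc : IsPathConnected U := by
    rw [hval.isPathConnected_iff]
    have : Subtype.val '' U = (range K)ᶜ := by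
      rw [show U = Subtype.val ⁻¹' (range K)ᶜ from rfl, Subtype.image_preimage_coe,
        inter_eq_right]
      exact fun x hx h => hx ⟨ptB, (mem_singleton_iff.1 h).symm⟩
    rw [this]
    exact ν.isPathConnected_compl_range
  have hmeet : IsPathConnected (U ∩ T) := by
    rw [hval.isPathConnected_iff]
    have : Subtype.val '' (U ∩ T) = ν '' ({p | p.1 ≠ ptB} ∩ {p | p.2 ≠ 0}) := by
      rw [show U ∩ T = Subtype.val ⁻¹' ((range K)ᶜ ∩ ν '' {p | p.1 ≠ ptB}) from rfl,
        Subtype.image_preimage_coe, ν.compl_range_inter_image, inter_eq_right]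
      rintro _ ⟨p, ⟨-, hp⟩, rfl⟩ h
      exact (ν.apply_mem_compl_range (x := p.1) hp) ⟨ptB, (mem_singleton_iff.1 h).symm⟩
    rw [this]
    refine IsPathConnected.image ?_ ν.continuous
    have h1 : IsPathConnected ({ptB}ᶜ : Set (𝕊 1)) := by
      rw [compl_ptB_eq_image]
      exact ((convex_Ioo _ _).isPathConnected ⟨1, by norm_num, by norm_num⟩).image
        continuous_circlePt
    have h2 : IsPathConnected ({0}ᶜ : Set (𝔼 2)) := by
      apply isPathConnected_compl_singleton_of_one_lt_rank
      rw [← Module.finrank_eq_rank, finrank_euclideanSpace_fin]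
      norm_num
    convert h1.prod h2 using 1
    ext p
    simp
  -- the base point lies in the tube
  have hxT : x₀ ∈ T :=
    ⟨(circlePoint 0, framingBaseVector), by
      rw [mem_setOf_eq, circlePoint_zero_eq_ptA]; exact ptA_ne_ptB, (ν.coe_basePoint).symm⟩
  -- the normal closure of the transported meridian
  let μ' : FundamentalGroup U (φ b) :=
    FundamentalGroup.fromPath (Path.Homotopic.Quotient.mk (ν.meridian.map φ.continuous))
  let N : Subgroup (FundamentalGroup U (φ b)) := Subgroup.normalClosure {μ'}
  haveI hN : N.Normal := Subgroup.normalClosure_normal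
  -- push-forward and pull-back of loop classes along `φ`, `ψ`
  have hφψ : ∀ y : U, φ (ψ y) = y := fun y => rfl
  have hψφ : ∀ x : K.complement, ψ (φ x) = x := fun x => rfl
  -- loops of `U` inside the tube are powers of the transported meridian
  have hNT : ∀ δ' : Path (φ b) (φ b), (∀ t, ((δ' t : U) : Y) ∈ T) →
      FundamentalGroup.fromPath (Path.Homotopic.Quotient.mk δ') ∈ N := by
    intro δ' hδ'
    let δ : Path b b := δ'.map ψ.continuous
    have hδ : ∀ t, (δ t : 𝕊 3) ∈ ν '' {p | p.1 ≠ ptB} := fun t => hδ' t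
    have hmem := ν.fromPath_mem_zpowers_meridian δ hδ
    obtain ⟨k, hk⟩ := Subgroup.mem_zpowers_iff.1 hmem
    have e1 := FundamentalGroup.mapOfEq_fromPath_eq φ (rfl : φ b = φ b) δ δ' fun t => rfl
    have e2 := FundamentalGroup.mapOfEq_fromPath_eq φ (rfl : φ b = φ b) ν.meridian
      (ν.meridian.map φ.continuous) fun t => rfl
    rw [← e1, ← hk, map_zpow, e2]
    exact Subgroup.zpow_mem _ (Subgroup.subset_normalClosure (mem_singleton _)) k
  -- van Kampen: every loop of `U` lies in `N`
  have hall : ∀ γ' : Path (φ b) (φ b),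
      FundamentalGroup.fromPath (Path.Homotopic.Quotient.mk γ') ∈ N := fun γ' =>
    Literature.AlgebraicTopology.FundamentalGroup.VanKampen.fromPath_mem_of_homotopic_refl (Y := Y) (U := U) (T := T) hUo hTo hUT hUpc hmeet
      hxU hxT N hNT γ' (SimplyConnectedSpace.paths_homotopic _ _)
  -- transfer back to the knot complement along `ψ`
  rw [eq_top_iff]
  rintro g -
  obtain ⟨γ, hγ⟩ := Path.Homotopic.Quotient.mk_surjective (FundamentalGroup.toPath g)
  rw [show g = FundamentalGroup.fromPath (Path.Homotopic.Quotient.mk γ) from hγ.symm]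
  let ψs : FundamentalGroup U (φ b) →* FundamentalGroup K.complement ν.basePoint :=
    FundamentalGroup.mapOfEq ψ (y := ν.basePoint) rfl
  have e3 : ψs (FundamentalGroup.fromPath (Path.Homotopic.Quotient.mk (γ.map φ.continuous))) =
      FundamentalGroup.fromPath (Path.Homotopic.Quotient.mk γ) :=
    FundamentalGroup.mapOfEq_fromPath_eq ψ (z := ν.basePoint) rfl (γ.map φ.continuous) γ
      fun t => rfl
  have e4 : ψs μ' = μ :=
    FundamentalGroup.mapOfEq_fromPath_eq ψ (z := ν.basePoint) rfl
      (ν.meridian.map φ.continuous) ν.meridian fun t => rfl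
  rw [← e3]
  have hle : N.map ψs ≤ Subgroup.normalClosure {μ} := by
    rw [Subgroup.map_le_iff_le_comap]
    haveI : ((Subgroup.normalClosure {μ}).comap ψs).Normal := Subgroup.Normal.comap inferInstance _
    refine Subgroup.normalClosure_le_normal ?_
    rintro _ rfl
    rw [SetLike.mem_coe, Subgroup.mem_comap, e4]
    exact Subgroup.subset_normalClosure (mem_singleton _)
  exact hle (Subgroup.mem_map_of_mem _ (hall _))

end VanKampen


/-! ### Existence of the framing integer; the uniqueness leaf; assembly -/

section Framing

variable {K : Knot} (ν : Knot.TubularNbhd K)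

/-- **`H₁(S³ ∖ K)` is generated by the meridian**: in the abelianised knot group
`π₁(S³ ∖ K, p₀)ᵃᵇ` every class is a power of the class of the meridian (Crowell–Fox, Ch. VIII
(1.1): "every abelian homomorphic image of a knot group is cyclic", generated by the image of a
meridian), from `normalClosure_meridian_eq_top`: the preimage of `⟨[μ]⟩` under the abelianisation
map is a normal subgroup containing `[μ]`. [cite: CrowellFox1963, Ch. VIII (1.1)] -/
theorem abelianization_mem_zpowers_meridian (g : FundamentalGroup K.complement ν.basePoint) :
    Abelianization.of g ∈ Subgroup.zpowers (Abelianization.of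
      (FundamentalGroup.fromPath (Path.Homotopic.Quotient.mk ν.meridian))) := by
  set μ : FundamentalGroup K.complement ν.basePoint :=
    FundamentalGroup.fromPath (Path.Homotopic.Quotient.mk ν.meridian) with hμ
  let H : Subgroup (FundamentalGroup K.complement ν.basePoint) :=
    (Subgroup.zpowers (Abelianization.of μ)).comap Abelianization.of
  haveI : H.Normal := Subgroup.Normal.comap inferInstance _
  have hle : Subgroup.normalClosure {μ} ≤ H := by
    refine Subgroup.normalClosure_le_normal ?_
    rintro _ rfl
    exact Subgroup.mem_zpowers _
  rw [hμ, ν.normalClosure_meridian_eq_top, top_le_iff] at hle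
  have hg : g ∈ H := hle ▸ Subgroup.mem_top g
  exact hg

/-- **Every oriented tubular neighbourhood has a framing integer**: there is `m : ℤ` with
`ν.HasFraming m`, i.e. `[longitude] = m • [meridian]` in `H₁(S³ ∖ K) = π₁ᵃᵇ` (the existence half
of `Knot.TubularNbhd.existsUnique_hasFraming`; Rolfsen, *Knots and Links*, §5.D, §9.F;
Crowell–Fox, Ch. VIII (1.1)). [cite: CrowellFox1963, Ch. VIII (1.1)] -/
theorem exists_hasFraming : ∃ m : ℤ, ν.HasFraming m := by
  obtain ⟨m, hm⟩ := Subgroup.mem_zpowers_iff.1 (ν.abelianization_mem_zpowers_meridian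
    (FundamentalGroup.fromPath (Path.Homotopic.Quotient.mk ν.longitude)))
  exact ⟨m, hm.symm⟩

/-- **The meridian has infinite order in `H₁(S³ ∖ K)`** (named fact, D-0014; the uniqueness half
of `Knot.TubularNbhd.existsUnique_hasFraming`). For every smooth knot `K : S¹ ↪ S³` and every
oriented tubular neighbourhood `ν` of `K`, the map `m ↦ m • [meridian]`, `ℤ → π₁(S³ ∖ K, p₀)ᵃᵇ`,
is injective. Printed source: Crowell–Fox, *Introduction to Knot Theory*, Ch. VIII (1.2) "The
abelianized group of any knot group is infinite cyclic", whose proof exhibits a homomorphism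
`θ` of the knot group **onto** the infinite cyclic group `(t)` with `θ(x_j) = t` for every
(meridian) generator `x_j` of an over presentation (tame knots; smooth knots are tame); with
(1.1), `H₁(S³ ∖ K) ≅ ℤ` is freely generated by the class of a meridian (Alexander duality;
Rolfsen, *Knots and Links*, §5.D). Not yet proved in the tree: it needs a linking-number
homomorphism `π₁(S³ ∖ K) → ℤ` taking the value `±1` on `ν.meridian` (e.g. Hurewicz
`π₁ᵃᵇ → H₁` and Mayer–Vietoris for `S³ = (S³ ∖ K) ∪ ν(S¹ × ℝ²)` with `H₂(S³) = 0`).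
[cite: CrowellFox1963, Ch. VIII (1.2)] -/
def zpow_meridian_injective : Prop :=
  ∀ (K : Knot) (ν : Knot.TubularNbhd K),
    Injective fun m : ℤ ↦ Abelianization.of
      (FundamentalGroup.fromPath (Path.Homotopic.Quotient.mk ν.meridian)) ^ m

/-- **The framing of a tubular neighbourhood is well defined, from the infinite order of the
meridian**: the named fact `Knot.TubularNbhd.existsUnique_hasFraming` (`∃! m, ν.HasFraming m`,
Rolfsen (1976), §5.D Thm 2, §9.F) follows from `exists_hasFraming` (proved above) and the leaf
`zpow_meridian_injective`. [cite: CrowellFox1963, Ch. VIII (1.1)–(1.2)] -/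
theorem existsUnique_hasFraming_of (h : zpow_meridian_injective) : ν.existsUnique_hasFraming := by
  obtain ⟨m, hm⟩ := ν.exists_hasFraming
  exact ⟨m, hm, fun m' hm' => h K ν (hm'.symm.trans hm)⟩

end Framing

end Knot.TubularNbhd

end Literature.Topology.FourManifolds
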